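import Summits.BirchSwinnertonDyer.BirchSwinnertonDyer.Theorems.ClassRecordThreeEulerHalvesAtThreeCartanTorusCubeCutPSChar
import Summits.BirchSwinnertonDyer.BirchSwinnertonDyer.Theorems.ClassRecordThreeEulerHalvesAtThreeCartanTorusCubeCut
import HarnessLib

/-!
# Crux 23422 line `cartan` v8′, stub (F2a), PRINCIPAL-SERIES half of the torus-cube cut — file PS-3: the three stubs
# (P1) `P_psNonsplitNormLower`, (P2) `P_psSplitNormSharp`, (P3) `P_psNonsplitNormSharp` REDUCED to the mod-3 line `X_M ⊂ X`

Seat `bsd-stepL-cartan-f2a` g0 (explicit unit, pen g44 AUTOFILL #2 row (3′); `--supports stmt-BirchSwinnertonDyer-23422 --as helper`).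
THE ONE MODULAR INPUT of the principal-series half, stated WITHOUT any new definition as hypotheses on a `ℤ`-submodule `X_M ⊂ X = ℤ^d`
(in the Steinberg dictionary `X_M = ker(λ : X ↠ X/3X ↠ 𝟙)`, `X_M/3X ≅ St ⊗ 𝔽₃`):
  `hline` : `X_M` is `G`-stable, contains `3X`, `G` acts trivially on `X/X_M`, and `X_M ≠ X`;
  `hsimple` : every `G`-stable `L` with `3X ⊆ L ⊆ X_M` is `X_M` or lies in `3X` (`X_M/3X` is a SIMPLE `𝔽₃[G]`-module);
  `hcyc` : `X = ℤx + X_M` for every `x ∉ X_M` (`X/X_M ≅ ℤ/3`);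
  `hU` : some `q`-element set `U ⊂ G` has `Σ_{u ∈ U} ρ(u) w_S = 0` (the unipotent radical: `X^B = 0`; a lattice fact, file PS-4);
  `hND` : `N_D(X_M) ⊄ 3X` (`N_D = Σ_a ρ(diag(a,1))`; from `N_D(St ⊗ 𝔽₃) ≠ 0`);
  `hcube` : some `u₀ ∉ X_M` and `d₀ ∈ G` have `u₀ + ρ(d₀)u₀ + ρ(d₀)²u₀ = 0` (a `U`-fixed vector outside `X_M`, which exists because
           `dim (St ⊗ 𝔽₃)^U = 1 < 2 = rk X^U`, killed by `1 + ρ(d₀) + ρ(d₀)²` for a non-cube `d₀ = diag(a,1)` — lattice fact, file PS-4).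
RESULTS (all sorry-free; `q ≡ 1 (mod 3)`, `q ≥ 5`):
* `normOp_nonsplitTorus_eq` : `N_{T_C} = (q − 1)·N̄_C`, `N̄_C = 1 + Σ_{a ∈ 𝔽_q} ρ(a·1 + η)` (a transversal of `Z` in `T_C`; LEMMA Z);
* `wC_not_mem` (`w_C ∉ X_M`), `wS_mem` (`w_S ∈ X_M`), `three_dvd_of_smul_wC_mem` (`X_M ∩ ℤw_C = 3ℤw_C`);
* **`psNonsplitNormLower_of_line`** — (P1) for the given lattice from `hline` + `hU`;
* **`psSplitNormSharp_of_line`** — (P2) from `hline` + `hsimple` + `hND` (+ `noFixedVectorModThree`);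
* **`psNonsplitNormSharp_of_line`** — (P3) from `hline` + `hsimple` + `hcyc` + `hU` + `hcube`, by the MOD-9 LATTICE ARGUMENT: if every
  `N̄_C(ρ(h)w_S)` lay in `9ℤw_C`, then with `X_S = ℤ[G]w_S` either `X_S + 3X_M = X_M` (⇒ `3(q+1)w_C = N̄_C(3w_C) ∈ 9ℤw_C`, absurd) or
  `S′ = X_S + 3X_M` is a complement: `X = ℤw_C + S′`, `3w_C ∉ S′`, `ρ(d₀)w_C ≡ e·w_C (mod S′)` with `e ≡ 1 (3)`, and
  `0 = u₀ + ρ(d₀)u₀ + ρ(d₀)²u₀ ≡ a(1+e+e²)w_C` with `3 ∤ a`, `1+e+e² = 3·(unit mod 3)` forces `3w_C ∈ S′` — contradiction. No group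
  cohomology (`H¹(G, St ⊗ 𝔽₃)`) is used.
What remains for the stubs BY NAME (files PS-4, PS-5): the lattice facts `hU`, `(1+ρ(d₀)+ρ(d₀)²)X^U = 0`, and the construction of `X_M` from
the Steinberg module `I₀ ⊂ 𝔽₃[P¹(𝔽_q)]` (simple for `3 ∤ q(q+1)` by an elementary mirabolic argument) with `hsimple`, `hcyc`, `hND`, `X^U ⊄ X_M`.
HONEST FRAMING: conditional reductions on one lattice; S-K1′ is NOT proved, no summit statement, no route item and no registered stub is
proved; BSD is proved for no curve. [folklore lattice arguments; background cite: Bump1997, §4.1]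
-/

namespace Summit.BirchSwinnertonDyer.BirchSwinnertonDyer.Theorems.CartanTorusCubeCut.PS

open Summit.BirchSwinnertonDyer.BirchSwinnertonDyer.Theorems.CartanDegree
open Summit.BirchSwinnertonDyer.BirchSwinnertonDyer.Theorems.CartanTorusCubeCut

set_option linter.dupNamespace false
set_option autoImplicit false

variable {q : ℕ} [Fact q.Prime]

/-! ### The transversal of the centre in the non-split torus: `N_{T_C} = (q − 1)·(1 + Σ_a ρ(a·1 + η))` -/

section Transversal
variable (𝓛 : CartanTorusLattice q)

/-- `a·1 + 0·η` (with `a ≠ 0`) is scalar, hence acts trivially. -/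
theorem rho_linGL_fst (a : ZMod q) (ha : a ≠ 0) :
    𝓛.ρ (linGL 𝓛.η 𝓛.η_irred (a, 0)) = 1 := by
  apply rho_eq_one_of_isScalar 𝓛
  have hp : ((a, (0 : ZMod q)) : ZMod q × ZMod q) ≠ 0 := fun h => ha (congrArg Prod.fst h)
  rw [linGL_coe 𝓛.η_irred hp]
  refine ⟨?_, ?_, ?_⟩ <;> simp [lin]

/-- `b·1 + t·η = (t·1) · ((b/t)·1 + η)` in `GL₂(𝔽_q)` for `t ≠ 0`. -/
theorem linGL_eq_scalar_mul {η : Mat q} (hη : ¬ HasRatEigenvalue η) (b : ZMod q) {t : ZMod q} (ht : t ≠ 0) :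
    linGL η hη (b, t) = diagGL ![Units.mk0 t ht, Units.mk0 t ht] * linGL η hη (b * t⁻¹, 1) := by
  apply Units.ext
  have hp : ((b, t) : ZMod q × ZMod q) ≠ 0 := fun h => ht (congrArg Prod.snd h)
  have hp' : ((b * t⁻¹, (1 : ZMod q)) : ZMod q × ZMod q) ≠ 0 := fun h => one_ne_zero (congrArg Prod.snd h)
  rw [Units.val_mul, linGL_coe hη hp, linGL_coe hη hp', diagGL_coe]
  have hdiag : (Matrix.diagonal fun i => ((![Units.mk0 t ht, Units.mk0 t ht] : Fin 2 → (ZMod q)ˣ) i : ZMod q)) =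
      t • (1 : Mat q) := by
    rw [Matrix.smul_one_eq_diagonal]
    congr 1
    funext i; fin_cases i <;> simp
  rw [hdiag, smul_mul_assoc, one_mul]
  simp only [lin, smul_add, smul_smul, one_smul, mul_comm t (b * t⁻¹), inv_mul_cancel_right₀ ht]

/-- on the lattice, `ρ(b·1 + t·η) = ρ((b/t)·1 + η)` for `t ≠ 0` (LEMMA Z). -/
theorem rho_linGL_snd_ne_zero (b : ZMod q) {t : ZMod q} (ht : t ≠ 0) :
    𝓛.ρ (linGL 𝓛.η 𝓛.η_irred (b, t)) = 𝓛.ρ (linGL 𝓛.η 𝓛.η_irred (b * t⁻¹, 1)) := by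
  rw [linGL_eq_scalar_mul 𝓛.η_irred b ht, map_mul,
    rho_eq_one_of_isScalar 𝓛 (isScalarMat_diagGL_const _), one_mul]

/-- **`N_{T_C} = (q − 1) · N̄_C`** with the transversal norm `N̄_C = 1 + Σ_{a ∈ 𝔽_q} ρ(a·1 + η)`. -/
theorem normOp_nonsplitTorus_eq :
    normOp 𝓛 (nonsplitTorus 𝓛.η) =
      ((q - 1 : ℕ) : ℤ) • (1 + ∑ a : ZMod q, 𝓛.ρ (linGL 𝓛.η 𝓛.η_irred (a, 1))) := by
  classical
  have hη := 𝓛.η_irred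
  rw [normOp, nonsplitTorus_eq_image hη, Finset.sum_image]
  swap
  · intro p hp p' hp' h
    have hp0 : p ≠ 0 := by simpa using hp
    have hp0' : p' ≠ 0 := by simpa using hp'
    have := congrArg (fun g : G q => (g : Mat q)) h
    simp only [linGL_coe hη hp0, linGL_coe hη hp0'] at this
    exact lin_injective hη this
  rw [← Finset.sum_filter_add_sum_filter_not _ (fun p : ZMod q × ZMod q => p.2 = 0)]
  -- the scalar part: `p = (a, 0)`, `a ≠ 0`
  have hA : ∑ p ∈ ((Finset.univ : Finset (ZMod q × ZMod q)).erase 0).filter (fun p => p.2 = 0),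
      𝓛.ρ (linGL 𝓛.η hη p) = ((q - 1 : ℕ) : ℤ) • (1 : (Fin 𝓛.d → ℤ) →ₗ[ℤ] (Fin 𝓛.d → ℤ)) := by
    have hset : ((Finset.univ : Finset (ZMod q × ZMod q)).erase 0).filter (fun p => p.2 = 0) =
        ((Finset.univ : Finset (ZMod q)).erase 0).image (fun a => (a, (0 : ZMod q))) := by
      ext p
      simp only [Finset.mem_filter, Finset.mem_erase, Finset.mem_univ, and_true, Finset.mem_image]
      constructor
      · rintro ⟨hp, h2⟩
        exact ⟨p.1, fun h1' => hp (Prod.ext h1' h2), Prod.ext rfl h2.symm⟩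
      · rintro ⟨a, ha, rfl⟩
        exact ⟨fun h => ha (congrArg Prod.fst h), rfl⟩
    rw [hset, Finset.sum_image (fun a _ b _ h => congrArg Prod.fst h)]
    have : ∀ a ∈ (Finset.univ : Finset (ZMod q)).erase 0, 𝓛.ρ (linGL 𝓛.η hη (a, 0)) = 1 :=
      fun a ha => rho_linGL_fst 𝓛 a (Finset.ne_of_mem_erase ha)
    rw [Finset.sum_congr rfl this, Finset.sum_const, Finset.card_erase_of_mem (Finset.mem_univ _),
      Finset.card_univ, ZMod.card, Nat.cast_smul_eq_nsmul]
  -- the non-scalar part: `p = (b, t)`, `t ≠ 0`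
  have hB : ∑ p ∈ ((Finset.univ : Finset (ZMod q × ZMod q)).erase 0).filter (fun p => ¬ p.2 = 0),
      𝓛.ρ (linGL 𝓛.η hη p) = ((q - 1 : ℕ) : ℤ) • ∑ a : ZMod q, 𝓛.ρ (linGL 𝓛.η hη (a, 1)) := by
    have hset : ((Finset.univ : Finset (ZMod q × ZMod q)).erase 0).filter (fun p => ¬ p.2 = 0) =
        (Finset.univ : Finset (ZMod q × ZMod q)).filter (fun p => ¬ p.2 = 0) := by
      ext p
      simp only [Finset.mem_filter, Finset.mem_erase, Finset.mem_univ, and_true, true_and, ne_eq,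
        and_iff_right_iff_imp]
      intro h2 h0
      exact h2 (by rw [h0]; rfl)
    rw [hset, Finset.sum_filter, ← Finset.univ_product_univ, Finset.sum_product_right]
    have hinner : ∀ t : ZMod q, (∑ b : ZMod q, if ¬ ((b, t) : ZMod q × ZMod q).2 = 0 then
        𝓛.ρ (linGL 𝓛.η hη (b, t)) else 0) =
        if t = 0 then 0 else ∑ a : ZMod q, 𝓛.ρ (linGL 𝓛.η hη (a, 1)) := by
      intro t
      by_cases ht : t = 0
      · simp [ht]
      · simp only [ht, not_false_eq_true, if_true, if_false]
        rw [Finset.sum_congr rfl (fun b _ => rho_linGL_snd_ne_zero 𝓛 b ht)]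
        exact Fintype.sum_equiv (Equiv.mulRight₀ t⁻¹ (inv_ne_zero ht)) _ _ (fun _ => rfl)
    rw [Finset.sum_congr rfl (fun t _ => hinner t), Finset.sum_ite, Finset.sum_const_zero, zero_add,
      Finset.sum_const, ← Nat.cast_smul_eq_nsmul ℤ]
    congr 1
    rw [Finset.filter_ne', Finset.card_erase_of_mem (Finset.mem_univ _), Finset.card_univ, ZMod.card]
  rw [hA, hB, smul_add]

/-- every `a·1 + η` lies in `T_C`, so fixes `w_C`. -/
theorem rho_linGL_wC {wC : Fin 𝓛.d → ℤ} (hC : 𝓛.IsNonsplitFixed wC) (a : ZMod q) :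
    𝓛.ρ (linGL 𝓛.η 𝓛.η_irred (a, 1)) wC = wC := by
  apply hC
  have hp : ((a, (1 : ZMod q)) : ZMod q × ZMod q) ≠ 0 := fun h => one_ne_zero (congrArg Prod.snd h)
  rw [linGL_coe 𝓛.η_irred hp]
  exact lin_comm 𝓛.η (a, 1)

/-- `N̄_C w_C = (q + 1)·w_C`. -/
theorem nbar_wC {wC : Fin 𝓛.d → ℤ} (hC : 𝓛.IsNonsplitFixed wC) :
    (1 + ∑ a : ZMod q, 𝓛.ρ (linGL 𝓛.η 𝓛.η_irred (a, 1))) wC = ((q : ℤ) + 1) • wC := by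
  rw [LinearMap.add_apply, LinearMap.sum_apply, Finset.sum_congr rfl (fun a _ => rho_linGL_wC 𝓛 hC a),
    Finset.sum_const, Finset.card_univ, ZMod.card, Module.End.one_apply, add_smul, one_smul, add_comm,
    Nat.cast_smul_eq_nsmul]

/-- `N̄_C x` is `T_C`-fixed (because `(q−1)·N̄_C x = N_{T_C} x` is). -/
theorem isNonsplitFixed_nbar (x : Fin 𝓛.d → ℤ) :
    𝓛.IsNonsplitFixed ((1 + ∑ a : ZMod q, 𝓛.ρ (linGL 𝓛.η 𝓛.η_irred (a, 1))) x) := by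
  intro t ht
  have hq : q.Prime := Fact.out
  have hfix := isNonsplitFixed_normOp 𝓛 x t ht
  rw [normOp_nonsplitTorus_eq, LinearMap.smul_apply, map_zsmul] at hfix
  have hq1 : ((q - 1 : ℕ) : ℤ) ≠ 0 := by
    have := hq.two_le
    exact_mod_cast (by omega : q - 1 ≠ 0)
  exact smul_right_injective _ hq1 hfix

end Transversal

/-! ### Consequences of the mod-3 line hypotheses -/

section Line
variable (𝓛 : CartanTorusLattice q) {XM : Submodule ℤ (Fin 𝓛.d → ℤ)}

omit [Fact q.Prime] in
/-- Bézout: if `3x ∈ X_M` and `n·x ∈ X_M` with `3 ∤ n`, then `x ∈ X_M`. -/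
theorem mem_of_smul_mem (h3 : ∀ x, (3 : ℤ) • x ∈ XM) {n : ℤ} (hn : ¬ (3 : ℤ) ∣ n) {x : Fin 𝓛.d → ℤ}
    (hx : n • x ∈ XM) : x ∈ XM := by
  have hcop : IsCoprime n 3 := by
    rw [Int.isCoprime_iff_gcd_eq_one]
    have h := Int.gcd_dvd_right n 3
    have h3' : (Int.gcd n 3 : ℤ) ∣ 3 := h
    rcases (Nat.dvd_prime Nat.prime_three).1 (by exact_mod_cast h3') with h1 | h1
    · exact h1
    · exfalso; apply hn
      have := Int.gcd_dvd_left n 3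
      rw [h1] at this
      exact_mod_cast this
  obtain ⟨a, b, hab⟩ := hcop
  have : x = a • (n • x) + b • ((3 : ℤ) • x) := by
    rw [smul_smul, smul_smul, ← add_smul, hab, one_smul]
  rw [this]
  exact XM.add_mem (XM.smul_mem a hx) (XM.smul_mem b (h3 x))

omit [Fact q.Prime] in
/-- a sum of `n` translates minus `n·x` lies in `X_M` when `G` acts trivially on `X/X_M`. -/
theorem sum_rho_sub_mem (htriv : ∀ (g : G q) (x : Fin 𝓛.d → ℤ), 𝓛.ρ g x - x ∈ XM) (S : Finset (G q))
    (x : Fin 𝓛.d → ℤ) : (∑ g ∈ S, 𝓛.ρ g x) - (S.card : ℤ) • x ∈ XM := by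
  have : (∑ g ∈ S, 𝓛.ρ g x) - (S.card : ℤ) • x = ∑ g ∈ S, (𝓛.ρ g x - x) := by
    rw [Finset.sum_sub_distrib, Finset.sum_const, ← Nat.cast_smul_eq_nsmul ℤ]
  rw [this]
  exact XM.sum_mem fun g _ => htriv g x

/-- `N̄_C x − (q+1)·x ∈ X_M`. -/
theorem nbar_sub_mem (htriv : ∀ (g : G q) (x : Fin 𝓛.d → ℤ), 𝓛.ρ g x - x ∈ XM) (x : Fin 𝓛.d → ℤ) :
    (1 + ∑ a : ZMod q, 𝓛.ρ (linGL 𝓛.η 𝓛.η_irred (a, 1))) x - ((q : ℤ) + 1) • x ∈ XM := by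
  have h := XM.sum_mem (t := (Finset.univ : Finset (ZMod q)))
    (fun a _ => htriv (linGL 𝓛.η 𝓛.η_irred (a, 1)) x)
  have e : (1 + ∑ a : ZMod q, 𝓛.ρ (linGL 𝓛.η 𝓛.η_irred (a, 1))) x - ((q : ℤ) + 1) • x =
      ∑ a : ZMod q, (𝓛.ρ (linGL 𝓛.η 𝓛.η_irred (a, 1)) x - x) := by
    rw [Finset.sum_sub_distrib, Finset.sum_const, Finset.card_univ, ZMod.card, LinearMap.add_apply,
      LinearMap.sum_apply, Module.End.one_apply, add_smul, one_smul, ← Nat.cast_smul_eq_nsmul ℤ]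
    abel
  rw [e]
  exact h

/-- **`w_C ∉ X_M`**: `N̄_C x ≡ (q+1)x (mod X_M)` lands in `ℤw_C`, so `w_C ∈ X_M` would force `X_M = X`. -/
theorem wC_not_mem
    (hline : (∀ g : G q, ∀ x ∈ XM, 𝓛.ρ g x ∈ XM) ∧ (∀ x, (3 : ℤ) • x ∈ XM) ∧
      (∀ (g : G q) (x : Fin 𝓛.d → ℤ), 𝓛.ρ g x - x ∈ XM) ∧ XM ≠ ⊤)
    (h1 : q % 3 = 1) {wC : Fin 𝓛.d → ℤ} (hCgen : ∀ v, 𝓛.IsNonsplitFixed v → ∃ m : ℤ, v = m • wC) :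
    wC ∉ XM := by
  obtain ⟨-, h3, htriv, hne⟩ := hline
  intro hwC
  apply hne
  rw [eq_top_iff]
  intro x _
  obtain ⟨c, hc⟩ := hCgen _ (isNonsplitFixed_nbar 𝓛 x)
  have hmem := nbar_sub_mem 𝓛 htriv x
  rw [hc] at hmem
  have hqx : ((q : ℤ) + 1) • x ∈ XM := by
    have := XM.sub_mem (XM.smul_mem c hwC) hmem
    simpa using this
  refine mem_of_smul_mem 𝓛 h3 (n := (q : ℤ) + 1) ?_ hqx
  omega

/-- **`X_M ∩ ℤw_C = 3ℤw_C`**: if `c·w_C ∈ X_M` then `3 ∣ c`. -/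
theorem three_dvd_of_smul_wC_mem
    (hline : (∀ g : G q, ∀ x ∈ XM, 𝓛.ρ g x ∈ XM) ∧ (∀ x, (3 : ℤ) • x ∈ XM) ∧
      (∀ (g : G q) (x : Fin 𝓛.d → ℤ), 𝓛.ρ g x - x ∈ XM) ∧ XM ≠ ⊤)
    (h1 : q % 3 = 1) {wC : Fin 𝓛.d → ℤ} (hCgen : ∀ v, 𝓛.IsNonsplitFixed v → ∃ m : ℤ, v = m • wC)
    {c : ℤ} (hc : c • wC ∈ XM) : (3 : ℤ) ∣ c := by
  by_contra h
  exact wC_not_mem 𝓛 hline h1 hCgen (mem_of_smul_mem 𝓛 hline.2.1 h hc)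

omit [Fact q.Prime] in
/-- **`w_S ∈ X_M`**: `Σ_{u ∈ U} ρ(u) w_S = 0` with `|U| = q` gives `q·w_S ∈ X_M`, and `3 ∤ q`. -/
theorem wS_mem
    (hline : (∀ g : G q, ∀ x ∈ XM, 𝓛.ρ g x ∈ XM) ∧ (∀ x, (3 : ℤ) • x ∈ XM) ∧
      (∀ (g : G q) (x : Fin 𝓛.d → ℤ), 𝓛.ρ g x - x ∈ XM) ∧ XM ≠ ⊤)
    (h1 : q % 3 = 1) {wS : Fin 𝓛.d → ℤ}
    (hU : ∃ U : Finset (G q), U.card = q ∧ ∑ u ∈ U, 𝓛.ρ u wS = 0) : wS ∈ XM := by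
  obtain ⟨-, h3, htriv, -⟩ := hline
  obtain ⟨U, hUcard, hU0⟩ := hU
  have hmem := sum_rho_sub_mem 𝓛 htriv U wS
  rw [hU0, hUcard, zero_sub, XM.neg_mem_iff] at hmem
  refine mem_of_smul_mem 𝓛 h3 (n := (q : ℤ)) ?_ hmem
  omega

end Line

/-! ### (P1) the non-split norm lower bound, from the line -/

/-- **(P1) for the given lattice, from the mod-3 line**: every `N_{T_C}(ρ(g) w_S)` is `m·w_C` with `3^{ord₃(q−1)+1} ∣ m`
(`ρ(g)w_S ∈ X_M`, `N̄_C(X_M) ⊆ X_M ∩ ℤw_C = 3ℤw_C`, and `N_{T_C} = (q−1)·N̄_C`). -/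
theorem psNonsplitNormLower_of_line (𝓛 : CartanTorusLattice q) (h1 : q % 3 = 1)
    {XM : Submodule ℤ (Fin 𝓛.d → ℤ)}
    (hline : (∀ g : G q, ∀ x ∈ XM, 𝓛.ρ g x ∈ XM) ∧ (∀ x, (3 : ℤ) • x ∈ XM) ∧
      (∀ (g : G q) (x : Fin 𝓛.d → ℤ), 𝓛.ρ g x - x ∈ XM) ∧ XM ≠ ⊤)
    {wS wC : Fin 𝓛.d → ℤ}
    (hU : ∃ U : Finset (G q), U.card = q ∧ ∑ u ∈ U, 𝓛.ρ u wS = 0)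
    (hCgen : ∀ v, 𝓛.IsNonsplitFixed v → ∃ m : ℤ, v = m • wC)
    (g : G q) (m : ℤ) (hm : normOp 𝓛 (nonsplitTorus 𝓛.η) (𝓛.ρ g wS) = m • wC) :
    (3 : ℤ) ^ (padicValNat 3 (q - 1) + 1) ∣ m := by
  have hwC : wC ≠ 0 := wC_ne_zero 𝓛 h1 hCgen
  have hy : 𝓛.ρ g wS ∈ XM := hline.1 g _ (wS_mem 𝓛 hline h1 hU)
  -- `N̄_C (ρ g wS) = c • wC` with `3 ∣ c`
  obtain ⟨c, hc⟩ := hCgen _ (isNonsplitFixed_nbar 𝓛 (𝓛.ρ g wS))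
  have hcmem : c • wC ∈ XM := by
    rw [← hc, LinearMap.add_apply, LinearMap.sum_apply, Module.End.one_apply]
    exact XM.add_mem hy (XM.sum_mem fun a _ => hline.1 _ _ hy)
  have h3c : (3 : ℤ) ∣ c := three_dvd_of_smul_wC_mem 𝓛 hline h1 hCgen hcmem
  -- `m = (q − 1)·c`
  rw [normOp_nonsplitTorus_eq, LinearMap.smul_apply, hc, smul_smul] at hm
  have hmc : ((q - 1 : ℕ) : ℤ) * c = m := smul_left_injective ℤ hwC hm
  rw [← hmc, pow_succ]
  have hq1 : ((3 ^ padicValNat 3 (q - 1) : ℕ) : ℤ) ∣ ((q - 1 : ℕ) : ℤ) :=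
    Int.natCast_dvd_natCast.2 pow_padicValNat_dvd
  push_cast at hq1
  exact mul_dvd_mul hq1 h3c

end Summit.BirchSwinnertonDyer.BirchSwinnertonDyer.Theorems.CartanTorusCubeCut.PS
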